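import Summits.HubbardSuperconductivity.HubbardSuperconductivity.Theses.BalabanIR

/-!
# Route BalabanIR — Assembly (item stmt-HubbardSuperconductivity-2085)

Pure logic over the summit Statement: the target `BirGroundStateAverageLRO` (ground-state-average
`d_{x²-y²}` pair-field LRO on an open window of couplings at one doping `δ ∈ (0,1/2)`) fed through
the crux `BirEveryGroundState` (average ⇒ every ground-state sequence, for SOME coupling of the
window) gives `HubbardSuperconductivity` verbatim: the witness coupling `U ∈ (U₁,U₂) ⊂ (0,∞)` is
positive by `lt_trans`, the doping is the same `δ`, and the conclusion of `BirEveryGroundState` is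
the body of `Literature.Hubbard.DWaveSuperconductivityHubbard` word for word.

**Repair 2026-08-16.** `assembly_proof` proved the rev-0/3 CURRIED assembly
`BirGroundStateAverageLRO → BirEveryGroundState → HubbardSuperconductivity` (item
stmt-HubbardSuperconductivity-2085, closed `proved` by it at e52f7c9d4e57, then detached). The rev-4
route repair restated the item UNDER THE SAME DECL NAME `Assembly` in uncurried frame form
`BirGroundStateAverageLRO ∧ BirEveryGroundState → HubbardSuperconductivity` (item
stmt-HubbardSuperconductivity-13907, closed by the cycle-free
`Theorems.BalabanIR.assembly_frame_proof`, `BalabanIRAssemblyFrame.lean`), so `intro hX hT` stopped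
elaborating ("introN failed", full builds of 2026-08-16). The theorem keeps its name and statement
text (Theorems files are append-only) and now proves the current `Assembly` by the same argument,
uncurried (`rintro ⟨hX, hT⟩`). It is a second, dependent proof of stmt-HubbardSuperconductivity-13907
and must NOT serve as that item's `Assembly_holds` link: this module imports the route module (see
the warning in the route file's `Assembly` docstring); `assembly_frame_proof` is the closing theorem.
-/

namespace Summit.HubbardSuperconductivity.HubbardSuperconductivity.Theorems

open Summit.HubbardSuperconductivity.HubbardSuperconductivity.Theses.BalabanIR

/-- **Assembly of route BalabanIR** (originally the curried item stmt-HubbardSuperconductivity-2085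
`BirGroundStateAverageLRO → BirEveryGroundState → HubbardSuperconductivity`, closed by this theorem;
since the rev-4 restate under the same decl name it proves the uncurried frame, item
stmt-HubbardSuperconductivity-13907 — see the module docstring).
Proof: destructure the target's witnesses `δ, U₁, U₂, c`, apply the average-to-every crux on the
window `(U₁,U₂)` to get a coupling `U ∈ (U₁,U₂)` at which every normalised sector ground-state
sequence has even-sides `d`-wave pair-field LRO, and repackage (`0 < U₁ < U`). -/
theorem assembly_proof :
    Summit.HubbardSuperconductivity.HubbardSuperconductivity.Theses.BalabanIR.Assembly := by
  unfold Assembly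
  -- rev ≥ 4: `Assembly` is the uncurried frame `X ∧ T → HubbardSuperconductivity`
  rintro ⟨hX, hT⟩
  obtain ⟨δ, hδ, U₁, U₂, c, hU₁, hU₁₂, hc, h⟩ := hX
  obtain ⟨U, hU, hLRO⟩ := hT δ U₁ U₂ c hδ hU₁ hU₁₂ hc h
  unfold _root_.HubbardSuperconductivity Literature.Hubbard.DWaveSuperconductivityHubbard
  exact ⟨U, lt_trans hU₁ hU.1, δ, hδ, hLRO⟩

end Summit.HubbardSuperconductivity.HubbardSuperconductivity.Theorems
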